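import Summits.PneNP.PneNP.Theses.SzkEntropy
import Summits.PneNP.PneNP.Theorems.SzkEntropyPeaThreeNotInP
import Summits.PneNP.PneNP.Theorems.SzkEntropyPeaThreeNotInPDegreeDial
import Summits.PneNP.PneNP.Theorems.SzkEntropyPeaThreeNotInPKillSwitch
import Summits.PneNP.PneNP.Theorems.SzkEntropyPeaThreeNotInPConsequences
import Literature.Computability.Complexity.PolynomialEntropyApproximation
import Literature.Computability.Complexity.PEASigmaTwo
import Literature.Computability.Complexity.PEAToPED
import Summits.PneNP.PneNP.Theorems.SzkEntropyPeaDegreeReduction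
import Summits.PneNP.PneNP.Theorems.PeaThreeNotInP.Negative.PEAOneMemPromiseP

/-!
# Disproof of `PeaThreeNotInP` (stmt-PneNP-10776) — standing adversary's work file (cdisprove)

Crux X = `Summit.PneNP.PneNP.Theses.SzkEntropy.PeaThreeNotInP` = `PEA 3 ∉ PromiseP`
(`szkEntropy_peaThreeNotInP_iff`, `Iff.rfl`): no language of `P` contains every sparse cubic map
over `F₂` with output entropy `≥ k + 1` and no such map with entropy `≤ k`.

## Findings (cycle 1, 2026-08-16)

* **No kill.**  X is an OPEN hardness statement, equivalent to `SZKP_L ⊄ prP`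
  [Dvir–Gutfreund–Rothblum–Vadhan 2010, Thm 1.1 / 4.7]; an unconditional `¬ X` is a deterministic
  polynomial-time algorithm for an `SZKP_L`-complete problem (hence for Graph Isomorphism,
  Quadratic Residuosity, DLOG, `GapCVP_√n`), and a proof of X is a lower bound stronger than
  `P ≠ NP` (`closes`).  Neither is available; see §4 for why no finite / degenerate attack bites.
* **Read-back audit (no junk).**  `PromiseP = promiseLift Classes.P` over Mathlib's `FinTM2`
  (finite control: `σ`, `Λ`, `K` are `Fintype`; auxiliary stack alphabets are only fed through
  `σ`, so effectively finite); encodings `sigmaBool / listBool³ / pairBool / encodeNat` are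
  injective, `n` and `k` binary, list headers unary; `H` is the exact Shannon entropy of `p(U_n)`
  (every fibre contains its point, so no `x / 0`, `logb 0` junk), `0 ≤ H ≤ n`.  Hence the yes/no
  string sets are disjoint (`PEA_disjoint`) — X is not true by overlap — and both are inhabited at
  EVERY threshold `k` (§1) — X is not false by a constant separator (§2).
* **Natural strengthenings that ARE false** (§3): "no language at all separates" (the yes-set
  does); "`PEA_3 ∉ promise-Σ₂ᵖ`" (tree: `PEAHash.PEA_mem_promiseLift_SigmaP_two`); "`PEA_d ∉
  PromiseP` for every `d`" (tree: `PEA_zero_mem_PromiseP`); and — this seat's negative lemmas under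
  `Theorems/PeaThreeNotInP/Negative/` —
  - "`PEA_d ∉ PromiseP` for every `d ≥ 1`" is FALSE: **`PEA_one_mem_PromiseP : PEA 1 ∈ PromiseP`**
    (LANDED p79963, `Negative/PEAOneMemPromiseP.lean`: Gaussian elimination on the linear part inside
    the tree's TM2 model via the typed `CodeFP` algebra, `H = rank`); with the PROVED degree
    reduction this gives the unconditional normal form **X ↔ ∃ d ≥ 2, PEA d ∉ PromiseP** and the
    dichotomy X ↔ (`PEA 2` hard) ∨ (`PEA 2` easy ∧ `PEA 3` hard) (§3b);
  - "X already at threshold `k = 0`" is FALSE: **`thresholdZero_slice_separated`** (proposed,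
    `Negative/ThresholdZeroSlice.lean`): for EVERY degree `d` the slice `k = 0` of `PEA d`
    (`H ≥ 1` vs `H ≤ 0`) is separated in `P` by the constant-function test (multilinear class
    parities; uniqueness of the multilinear normal form over `F₂`), so the hardness X asserts is
    quantitative (`k ≥ 1`, approximate fibre counting) and single-output maps carry none of it.
* **Already landed by provers (cited, not redone):** `X ∨ PeaThreeMemBPP` and, under promise
  derandomisation (`PromiseBPP' ⊆ PromiseP`, e.g. from a `2^{εn}`-hard language in `E`),
  `X ↔ ¬ PeaThreeMemBPP` (`SzkEntropyPeaThreeNotInPKillSwitch.lean`); `X → Σ₂ᵖ ⊄ P → NP ⊄ P`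
  (`…Consequences.lean`); `PEA 0 ∈ PromiseP`, `X ↔ ∃ d ≥ 1, PEA d ∉ PromiseP` given
  `PeaDegreeReduction` (`…DegreeDial.lean`).

Prose lives in docstrings only; every `theorem` below is kernel-checked (no `sorry` in §0–§3).
-/

namespace Summit.PneNP.PneNP.Cruxes.PeaThreeNotInP.Disproof

set_option linter.dupNamespace false

open Literature.Computability.Complexity _root_.Computability
open Summit.PneNP.PneNP.Theses.SzkEntropy Summit.PneNP.PneNP.Theorems

/-! ### §0. What X says: no separator in `P` -/

/-- X unfolded: no polynomial-time language contains all yes-strings of `PEA 3` and avoids all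
no-strings. [Goldreich 2006, Def. 1.2] -/
theorem peaThreeNotInP_iff_forall_not_separates :
    PeaThreeNotInP ↔ ∀ L ∈ Classes.P, ¬ ((PEA 3).yes ≤ L ∧ (PEA 3).no ≤ Lᶜ) :=
  ⟨fun hX L hL hsep => szkEntropy_peaThreeNotInP_iff.1 hX ⟨L, hL, hsep⟩,
    fun h => szkEntropy_peaThreeNotInP_iff.2 fun ⟨L, hL, hsep⟩ => h L hL hsep⟩

/-! ### §1. Non-vacuity: explicit yes- and no-instances at every threshold -/

/-- The coordinate (identity) map on `n` variables, `x ↦ (x₀, …, x_{n-1})`, sparsely: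
`[[[0]], [[1]], …, [[n-1]]]` (one linear monomial per output). -/
def coordMap (n : ℕ) : PolyMapF2 n := (List.finRange n).map fun i => [[i]]

/-- The zero map with `m` outputs on `n` variables: every output polynomial is empty. -/
def zeroMap (n m : ℕ) : PolyMapF2 n := List.replicate m []

/-- The coordinate map lists the coordinates. -/
theorem eval_coordMap (n : ℕ) (x : Fin n → ZMod 2) :
    (coordMap n).eval x = (List.finRange n).map x := by
  simp [coordMap, PolyMapF2.eval]

/-- The coordinate map is injective. -/
theorem eval_coordMap_injective (n : ℕ) : Function.Injective (coordMap n).eval := by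
  intro x y h
  rw [eval_coordMap, eval_coordMap] at h
  funext i
  exact List.map_inj_left.1 h i (List.mem_finRange i)

/-- The zero map is constantly `0^m`. -/
theorem eval_zeroMap (n m : ℕ) (x : Fin n → ZMod 2) :
    (zeroMap n m).eval x = List.replicate m 0 := by
  simp [zeroMap, PolyMapF2.eval, List.map_replicate]

/-- The coordinate map has degree `1`. -/
theorem degLE_coordMap (n : ℕ) {d : ℕ} (hd : 1 ≤ d) : (coordMap n).DegLE d := by
  intro p hp μ hμ
  simp only [coordMap, List.mem_map, List.mem_finRange, true_and] at hp
  obtain ⟨i, rfl⟩ := hp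
  simp only [List.mem_singleton] at hμ
  subst hμ
  simpa using hd

/-- The zero map has every degree bound. -/
theorem degLE_zeroMap (n m d : ℕ) : (zeroMap n m).DegLE d := by
  intro p hp μ hμ
  simp only [zeroMap, List.mem_replicate] at hp
  obtain ⟨-, rfl⟩ := hp
  simp at hμ

/-- `H(coordMap n (U_n)) = n` bits (injective map: flat on `2ⁿ` points). -/
theorem entropy_coordMap (n : ℕ) : (coordMap n).entropy = n := by
  unfold PolyMapF2.entropy
  rw [Literature.InformationTheory.Entropy.mapEntropy_of_injective _ (eval_coordMap_injective n),
    Finset.card_univ, Fintype.card_pi, Finset.prod_const, ZMod.card, Finset.card_univ,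
    Fintype.card_fin]
  push_cast
  rw [Real.logb_pow, Real.logb_self_eq_one (by norm_num), mul_one]

/-- `H(zeroMap (U_n)) = 0` (constant map). -/
theorem entropy_zeroMap (n m : ℕ) : (zeroMap n m).entropy = 0 := by
  unfold PolyMapF2.entropy
  have : (zeroMap n m).eval = fun _ => List.replicate m 0 := funext (eval_zeroMap n m)
  rw [this]
  exact Literature.InformationTheory.Entropy.mapEntropy_const _ _

/-- The yes-witness at threshold `k`: the coordinate map on `k + 1` variables (`H = k + 1`). -/
def yesInst (k : ℕ) : PEAInst := ⟨k + 1, (coordMap (k + 1), k)⟩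

/-- The no-witness at threshold `k` with the SAME format (`n = m = k + 1`): the zero map (`H = 0`). -/
def noInst (k : ℕ) : PEAInst := ⟨k + 1, (zeroMap (k + 1) (k + 1), k)⟩

/-- For every `d ≥ 1` and every threshold `k`, the code of `yesInst k` is a yes-string of `PEA d`. -/
theorem encode_yesInst_mem_yes {d : ℕ} (hd : 1 ≤ d) (k : ℕ) :
    PEAInst.encoding.encode (yesInst k) ∈ (PEA d).yes := by
  rw [encode_mem_PEA_yes_iff]
  refine ⟨degLE_coordMap _ hd, ?_⟩
  change ((k : ℕ) : ℝ) + 1 ≤ (coordMap (k + 1)).entropy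
  rw [entropy_coordMap]
  push_cast
  exact le_rfl

/-- For every `d` and every threshold `k`, the code of `noInst k` is a no-string of `PEA d`. -/
theorem encode_noInst_mem_no (d k : ℕ) :
    PEAInst.encoding.encode (noInst k) ∈ (PEA d).no := by
  rw [encode_mem_PEA_no_iff]
  refine ⟨degLE_zeroMap _ _ _, ?_⟩
  change (zeroMap (k + 1) (k + 1)).entropy ≤ ((k : ℕ) : ℝ)
  rw [entropy_zeroMap]
  exact Nat.cast_nonneg k

/-- Both sides of the promise of `PEA d`, `d ≥ 1`, are inhabited at every threshold `k`, by two
instances of the same format `(n, m, k) = (k+1, k+1, k)`: a separator must read the monomials. -/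
theorem exists_yes_no_same_format {d : ℕ} (hd : 1 ≤ d) (k : ℕ) :
    ∃ I J : PEAInst, I.1 = J.1 ∧ I.2.1.length = J.2.1.length ∧ I.2.2 = k ∧ J.2.2 = k ∧
      PEAInst.encoding.encode I ∈ (PEA d).yes ∧ PEAInst.encoding.encode J ∈ (PEA d).no :=
  ⟨yesInst k, noInst k, rfl, by simp [yesInst, noInst, coordMap, zeroMap], rfl, rfl,
    encode_yesInst_mem_yes hd k, encode_noInst_mem_no d k⟩

/-- `PEA d`, `d ≥ 1`, has a yes-string. -/
theorem PEA_yes_nonempty {d : ℕ} (hd : 1 ≤ d) : ((PEA d).yes : Set (List Bool)).Nonempty :=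
  ⟨_, encode_yesInst_mem_yes hd 0⟩

/-- `PEA d` has a no-string. -/
theorem PEA_no_nonempty (d : ℕ) : ((PEA d).no : Set (List Bool)).Nonempty :=
  ⟨_, encode_noInst_mem_no d 0⟩

/-! ### §1b. Format-only regions: yes-instances need `k < m` and `k < n`

The threshold `k` is binary, so most of the instance space (`k ≥ m` or `k ≥ n`) carries no
yes-instance at all (`H ≤ m`, `H ≤ n`); there the empty language separates.  Any hardness of X
lives in the region `k < min (m, n)`. -/

/-- `H(P(U_n)) ≤ n`: the output entropy is at most the input entropy. -/
theorem entropy_le_nvars {n : ℕ} (P : PolyMapF2 n) : P.entropy ≤ n := by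
  unfold PolyMapF2.entropy
  refine (Literature.InformationTheory.Entropy.mapEntropy_le_logb_card _ _).trans (le_of_eq ?_)
  rw [Finset.card_univ, Fintype.card_pi, Finset.prod_const, ZMod.card, Finset.card_univ,
    Fintype.card_fin]
  push_cast
  rw [Real.logb_pow, Real.logb_self_eq_one (by norm_num), mul_one]

/-- A yes-instance `(n, P, k)` of `PEA d` has `k < m` (number of output polynomials). -/
theorem threshold_lt_length_of_mem_yes {d : ℕ} {I : PEAInst}
    (h : PEAInst.encoding.encode I ∈ (PEA d).yes) : I.2.2 < I.2.1.length := by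
  rw [encode_mem_PEA_yes_iff] at h
  have h1 := h.2.trans (PolyMapF2.entropy_le_length I.2.1)
  exact_mod_cast (show ((I.2.2 : ℕ) : ℝ) < I.2.1.length by linarith)

/-- A yes-instance `(n, P, k)` of `PEA d` has `k < n` (number of variables). -/
theorem threshold_lt_nvars_of_mem_yes {d : ℕ} {I : PEAInst}
    (h : PEAInst.encoding.encode I ∈ (PEA d).yes) : I.2.2 < I.1 := by
  rw [encode_mem_PEA_yes_iff] at h
  have h1 := h.2.trans (entropy_le_nvars I.2.1)
  exact_mod_cast (show ((I.2.2 : ℕ) : ℝ) < I.1 by linarith)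

/-- The high-threshold slice `{(n, P, k) : min m n ≤ k}` of `PEA d` is in promise-`P` for every `d`:
it has no yes-strings, so the empty language (in `P`, `empty_mem_P`) separates it. -/
theorem highThreshold_slice_separated (d : ℕ) :
    ∃ L ∈ Classes.P,
      PEAInst.encoding.toLanguage
          {I | (I.2.1.DegLE d ∧ (I.2.2 : ℝ) + 1 ≤ I.2.1.entropy) ∧ min I.2.1.length I.1 ≤ I.2.2} ≤ L ∧
      PEAInst.encoding.toLanguage
          {I | (I.2.1.DegLE d ∧ I.2.1.entropy ≤ (I.2.2 : ℝ)) ∧ min I.2.1.length I.1 ≤ I.2.2} ≤ Lᶜ := by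
  refine ⟨((∅ : Set (List Bool)) : Language Bool), empty_mem_P, ?_, fun _ _ h => h⟩
  rintro w ⟨I, ⟨hI, hk⟩, rfl⟩
  have hy : PEAInst.encoding.encode I ∈ (PEA d).yes := (encode_mem_PEA_yes_iff d I).2 hI
  have h1 := threshold_lt_length_of_mem_yes hy
  have h2 := threshold_lt_nvars_of_mem_yes hy
  exact absurd hk (by omega)

/-! ### §2. Junk separators fail (X is not refutable by a constant answer) -/

/-- The empty language does not separate `PEA d`, `d ≥ 1` (it misses a yes-string). -/
theorem empty_not_separates {d : ℕ} (hd : 1 ≤ d) :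
    ¬ ((PEA d).yes ≤ ((∅ : Set (List Bool)) : Language Bool)) := fun h =>
  (PEA_yes_nonempty hd).elim fun _ hw => h hw

/-- The full language does not separate `PEA d` (it contains a no-string). -/
theorem univ_not_separates (d : ℕ) :
    ¬ ((PEA d).no ≤ (((Set.univ : Set (List Bool)) : Language Bool))ᶜ) := fun h =>
  (PEA_no_nonempty d).elim fun _ hw => h hw trivial

/-- Any separating language of `PEA d`, `d ≥ 1`, is a proper non-empty language. -/
theorem separator_ne_bot_top {d : ℕ} (hd : 1 ≤ d) {L : Language Bool}
    (hy : (PEA d).yes ≤ L) (hn : (PEA d).no ≤ Lᶜ) :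
    L ≠ ((∅ : Set (List Bool)) : Language Bool) ∧ L ≠ ((Set.univ : Set (List Bool)) : Language Bool) := by
  constructor
  · rintro rfl; exact empty_not_separates hd hy
  · rintro rfl; exact univ_not_separates d hn

/-! ### §3. Natural strengthenings of X that are FALSE -/

/-- Dropping the resource bound kills nothing: SOME language separates `PEA 3` (its yes-set), so
the entire content of X is the polynomial-time bound. -/
theorem mem_promiseLift_univ (d : ℕ) : PEA d ∈ promiseLift (Set.univ : Set (Language Bool)) :=
  ⟨(PEA d).yes, trivial, le_rfl, (PEA_disjoint d).le_compl_left⟩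

/-- Strengthening X to `promise-Σ₂ᵖ` is false: `PEA 3 ∈ promiseLift (SigmaP 2)` (tree, Sipser
hashing). So X asserts hardness strictly between `P` and `Σ₂ᵖ ∩ …`. -/
theorem not_strengthening_SigmaP_two : ¬ (PEA 3 ∉ promiseLift (SigmaP 2)) := fun h =>
  h (PEAHash.PEA_mem_promiseLift_SigmaP_two 3)

/-- Strengthening X to `promise-PH` is false (route support `PeaMemPH`, proved). -/
theorem not_strengthening_PH : ¬ (PEA 3 ∉ promiseLift PH) := fun h =>
  h (PEAHash.PEA_mem_promiseLift_PH 3)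

/-- Strengthening X to all degrees is false at `d = 0` (tree: `PEA_zero_mem_PromiseP`). -/
theorem not_strengthening_all_degrees : ¬ (∀ d : ℕ, PEA d ∉ PromiseP) := fun h =>
  h 0 PEA_zero_mem_PromiseP

/-! ### §3b. The degree dial after `PEA_one_mem_PromiseP` (landed p79963) -/

open Summit.PneNP.PneNP.Theorems.PeaThreeNotInP.Negative in
/-- **Unconditional normal form of X along the degree dial**: since `PeaDegreeReduction` is PROVED
(`szkEntropy_peaDegreeReduction_proof`, AIK randomizing polynomials) and degrees `0, 1` are easy
(`PEA_zero_mem_PromiseP`, `PEA_one_mem_PromiseP`), thesis X holds iff entropy approximation is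
outside promise-`P` in SOME degree `d ≥ 2`. -/
theorem peaThreeNotInP_iff_exists_two_le :
    PeaThreeNotInP ↔ ∃ d : ℕ, 2 ≤ d ∧ PEA d ∉ PromiseP := by
  rw [szkEntropy_peaThreeNotInP_iff_exists_of_peaDegreeReduction szkEntropy_peaDegreeReduction_proof]
  exact ⟨fun ⟨d, hd⟩ => ⟨d, two_le_of_PEA_not_mem_PromiseP' hd, hd⟩, fun ⟨d, _, hd⟩ => ⟨d, hd⟩⟩

/-- **Dichotomy**: X ↔ (the quadratic rung is already hard) ∨ (quadratics are easy and cubics are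
hard).  The first disjunct is `¬`(derandomised `PeaTwoMemBPP`); the second says hardness is
GENUINELY cubic.  Either way nothing below degree `2` contributes. -/
theorem peaThreeNotInP_iff_quadratic_or_cubic :
    PeaThreeNotInP ↔ PEA 2 ∉ PromiseP ∨ (PEA 2 ∈ PromiseP ∧ PEA 3 ∉ PromiseP) := by
  rw [szkEntropy_peaThreeNotInP_iff]
  constructor
  · intro h3
    by_cases h2 : PEA 2 ∈ PromiseP
    · exact Or.inr ⟨h2, h3⟩
    · exact Or.inl h2
  · rintro (h2 | ⟨-, h3⟩)
    · exact PEA_not_mem_promiseLift_mono (by norm_num : 2 ≤ 3) h2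
    · exact h3

/-- **Unconditionally, every degree `d ≥ 3` gives the same statement as X** (the provers'
`szkEntropy_peaThreeNotInP_iff_of_peaDegreeReduction` with the degree reduction discharged). -/
theorem peaThreeNotInP_iff_degree {d : ℕ} (hd : 3 ≤ d) : PeaThreeNotInP ↔ PEA d ∉ PromiseP :=
  szkEntropy_peaThreeNotInP_iff_of_peaDegreeReduction szkEntropy_peaDegreeReduction_proof hd

open Summit.PneNP.PneNP.Theorems.PeaThreeNotInP.Negative in
/-- Strengthening X to all POSITIVE degrees is false (at `d = 1`). -/
theorem not_strengthening_pos_degrees : ¬ (∀ d : ℕ, 1 ≤ d → PEA d ∉ PromiseP) :=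
  not_forall_pos_degree_PEA_not_mem_PromiseP

open Summit.PneNP.PneNP.Theorems.PeaThreeNotInP.Negative in
/-- At degree `1` even the gap is vacuous: every affine instance is a yes- or a no-instance
(`H = rank ∈ ℕ`), in contrast with degree `≥ 2` where `H` is typically irrational. -/
theorem degree_one_promise_total (I : PEAInst) (h : I.2.1.DegLE 1) :
    PEAInst.encoding.encode I ∈ (PEA 1).yes ∨ PEAInst.encoding.encode I ∈ (PEA 1).no :=
  PEA_one_promise_total I h

/-! ### §4. Why X resists every cheap attack (docstring record)

* Finite models / `decide`: X is `¬ ∃ L ∈ P, …` over an infinite family; no finite fragment of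
  `PEA 3` is hard (for fixed `n` brute force is a constant-size table), and no finite computation
  refutes a class non-membership.  Small-model computation can only test HEURISTICS for the
  algorithmic side (route falsifier (2), crux `PeaTwoMemBPP`), not X.
* Degenerate parameters: `d = 0` easy (landed), `d = 1` easy (this seat, `PEA_one_mem_PromiseP`,
  landed), `d = 2` open both ways (crux `PeaTwoMemBPP`), `d ≥ 3` all equivalent to X (degree
  reduction proved); `k ≥ min (m, n)` carries no yes-instance (§1b); `k = 0` easy at every degree
  (this seat, `thresholdZero_slice_separated`: constant-function test), hence `m = 1` easy; `m =
  O(log n)` is in `prBPP` by sampling (so in `prP` under derandomisation — not formalised here).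
  None of these is a refutation: X lives at `k ≥ 1`, `m, n` unbounded, degree `2` or `3`.
* Junk models of the interface: none — `PromiseP`, the encodings and `H` are concrete (§ audit).
* Known counterexample families: an algorithm for `PEA 3` = `SZKP_L ⊆ P`; none in print
  (DGRV 2010; Allender et al. 2023/2025 on `NISZK_L`; Babai 2016 gives only quasi-poly GI).
* Barrier reductions: relativization / algebrization bite PROOFS of X, not its truth; they give no
  `¬ X`.
-/

/-! ### §5. Line `SketchIdeator3` (PICKED 2026-08-16T06:17Z; card `tensor-iso-monoid-import`) — adversary notes

The picked line does not attack X head-on: it builds a CERTIFIED Cook reduction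
`(ofLanguage TI).CookReducible (PEA 3)` (TI = concise 3-Tensor Isomorphism over `F₂`, via the
monoid-randomised sampler `M ↦ M·S` on ALL matrix triples, the proved law-invariance
`law_eq_of_iso` / `samplerEntropy_eq_of_iso`, the proved Jensen–Shannon accounting lemma
`mixture_entropy_ge`, direct products, `PED 4 → PEA 4 →` (tree, proved) `PEA 3`) and then
transfers the OPEN conjecture C⁺ := `TI ∉ P` into X by the proved `peaThreeNotInP_of_cookHard`.
Joint sufficiency: the stub set {reduction pieces} ∪ {C⁺} does give X (transfer proved); but C⁺ is
logically STRONGER than X (TI ≤ PEA₃ makes `¬X → ¬C⁺`), so the line re-labels X's open content, it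
does not shrink it — honest in PICKED.md.  Nothing to kill; two technical traps for the lead,
recorded here because a stub stated without them would be FALSE as stated:

1. **The isomorphic case lands ON the gap, not in NO.**  With `p := mix^{×2t}` and
   `q := (S-sampler × T-sampler)^{×t}`, `S ≅ T` gives `H(p) = H(q)` EXACTLY, which is neither a
   yes- (`H(p) ≥ H(q)+1`) nor a no-instance (`H(p)+1 ≤ H(q)`) of `PED 4`; a stub
   "`S ≅ T → reduce (S,T) ∈ (PED 4).no`" is false unless `q` carries one extra uniform coordinate
   (entropy `+1`; then iso ↦ `H(p)+1 = H(q)` ∈ NO and non-iso ↦ `H(p) ≥ H(q)+1` once `2tπ ≥ 2`,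
   `π = P[GL_n(F₂)]³ ≥ 0.0241 ≥ 1/64`).
2. **The `PED → PEA` Cook step must be robust to gap answers.**  The tree's
   `PromiseProblem.CookReducible` is Goldreich's Definition 3 (correct output for EVERY oracle that
   answers `[true]`/`[false]` on the promise and ARBITRARILY elsewhere), which is what makes
   `mem_PromiseP_of_cookReducible_holds` true; plain binary search on thresholds `k` consults gap
   queries (`H ∈ (k, k+1)`) and can be steered arbitrarily.  Robust form: amplify first
   (`p ↦ p^{×8}`, gaps scale, `GapRobustness.lean`), then ask ALL thresholds `k = 0..m`
   non-adaptively and COUNT yes-answers (at most one threshold per map is in the gap, so the count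
   locates `H` within `±1`), cf. `cookReducible_of_truthTable`.
3. (degree) the selector bit makes the mixture map degree `4`; `PEA 4 → PEA 3` is the tree's proved
   `PEA_polyTimeReducible_PEA_three`, so no `encodeBDDs` re-encoding of the selector is needed —
   agreed with PICKED.md.

Handed to this seat by TRIAGE-r1-2 (kept for the Negative lane, cycle 2): the DISPROOF PRICE rider
`¬X → CAPP_BDD ∈ prFP` (deterministic approximate counting for branching programs, via the tree's
`entropy_encodeBDDsMap`: `H(encode(B ∧ y₁ ∧ y₂)) = m + h(p/4)`, `t` copies and `t+1` threshold
queries locate `t·h(p/4)` within `2`, `h` is `log₂3`-bi-Lipschitz on `[0,1/4]`), after which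
[Chen–Lyu–Williams, FOCS 2020, Thm 1.2] turns a refutation of X into `E^NP` lower bounds against
`2^{n^δ}`-size branching programs — i.e. refuting X is at least a breakthrough derandomisation.
Formal target: `capp_bdd_of_not_peaThreeNotInP` (needs the FP certificate of `Bs ↦ encodeBDDsMap`,
flagged "NOT here" in `BranchingProgramEncoding.lean`).  UPDATE (this seat, brick 1 proposed p89732
`Negative/MaskedUniformEntropy.lean`): NO enclosure of `h` is needed — replace `B ∧ y₁ ∧ y₂` by the
MASKED-UNIFORM gadget `Z(x, y) = if B x then y else 0` with `L` fresh bits: `p·L − 1 ≤ H(Z) ≤ p·L + 1`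
(`mapEntropy_masked_bounds`), entropy AFFINE in `p`, so with `L = 2^{e+3}` ONE `PEA 3` instance at the
integer threshold `k = m + ⌈aL⌉ + 3` decides `p ≥ a + 2^{-e}` vs `p ≤ a` — a KARP reduction
`CAPP_dec ≤ₚ PEA 3` (robustness automatic), hence `¬X → gap-CAPP_BDD ∈ PromiseP`. -/

end Summit.PneNP.PneNP.Cruxes.PeaThreeNotInP.Disproof
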